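import Mathlib
import Literature.Analysis.Complex.SimilarityRegularisation
import Literature.Analysis.Complex.ApproximateHolomorphy
import Literature.Topology.PlaneTopology.WindingNumber
import HarnessLib

/-!
# The regularised approximants `h_t = e^{-s_t} w` of the similarity principle

Technical half of `Literature/Analysis/Complex/SimilarityPrinciple.lean` (the smooth
`δ`-regularised proof of the Carleman–Bers–Vekua similarity principle, Wendl (2020) App. B
Thm B.20): for `w` smooth with `∂̄ w = r`, `‖r‖ ≤ M ‖w‖` on `‖z‖ ≤ ρ`,

* `Similarity.exists_approx` — for each `t > 0` a smooth potential `s` (`‖s‖ ≤ S` on the disc) and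
  a function `H` holomorphic on `‖z‖ < ρ'` with `‖e^{-s} w - H‖ ≤ C e^S M t / 2` on `‖z‖ ≤ ρ'`
  (regularised coefficient + Cauchy potential + approximate holomorphy);
* `Similarity.wind_eq_of_approx` — Rouché transfer: if `H_k → H` locally uniformly with
  `‖e^{-s_k} w - H_k‖ → 0`, then `wind (w ∘ γ) = wind (H ∘ γ)` along every circle on which `w`
  and `H` are zero-free (the exponential factor does not wind);
* `Similarity.norm_le_of_tendsto`, `Similarity.exists_radius` — two elementary lemmas (passing
  two-sided bounds to a limit; isolated zeros of a holomorphic function on a disc).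

Provenance: `Theorems/SullivanDualTameOrBrodyR4HelperLocalZeroIsolatedPositive.lean` of summit
`SmoothPoincare4` (crux `TameOrBrodyR4`), re-homed (promotion event 3639839).

## References

* C. Wendl, *Lectures on Contact 3-Manifolds, Holomorphic Curves and Intersection Theory* (2020),
  App. B, Thm B.20. [Wendl2020]
-/

noncomputable section

open scoped ContDiff ComplexConjugate Topology
open Filter Set Metric
open Literature.Topology.PlaneTopology

namespace Literature.Analysis.Complex

namespace Similarity

/-! ### Passing two-sided bounds to a limit -/

/-- If `u k → L`, `‖v k - u k‖ ≤ e k` with `e k → 0`, and `lo ≤ ‖v k‖ ≤ hi` for all `k`, then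
`lo ≤ ‖L‖ ≤ hi`. [folklore] -/
theorem norm_le_of_tendsto {u v : ℕ → ℂ} {L : ℂ} {e : ℕ → ℝ} {lo hi : ℝ}
    (hu : Tendsto u atTop (𝓝 L)) (he : Tendsto e atTop (𝓝 0))
    (hclose : ∀ k, ‖v k - u k‖ ≤ e k) (hlo : ∀ k, lo ≤ ‖v k‖) (hhi : ∀ k, ‖v k‖ ≤ hi) :
    lo ≤ ‖L‖ ∧ ‖L‖ ≤ hi := by
  have hn : Tendsto (fun k => ‖u k‖) atTop (𝓝 ‖L‖) := hu.norm
  constructor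
  · have h1 : Tendsto (fun k => lo - e k) atTop (𝓝 (lo - 0)) := tendsto_const_nhds.sub he
    rw [sub_zero] at h1
    refine le_of_tendsto_of_tendsto' h1 hn fun k => ?_
    have := norm_sub_norm_le (v k) (u k)
    linarith [hclose k, hlo k]
  · have h1 : Tendsto (fun k => hi + e k) atTop (𝓝 (hi + 0)) := tendsto_const_nhds.add he
    rw [add_zero] at h1
    refine le_of_tendsto_of_tendsto' hn h1 fun k => ?_
    have := norm_sub_norm_le (u k) (v k)
    rw [norm_sub_rev] at this
    linarith [hclose k, hhi k]

/-! ### Isolated zeros of the holomorphic limit -/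

/-- A function holomorphic on the disc `‖z‖ < ρ'` and not vanishing at some point `z₁` of the disc
is zero-free on a small punctured closed disc `0 < ‖z - z₀‖ ≤ ε` around any point `z₀` of the
disc, with `‖z₀‖ + ε < ρ'` (identity theorem on the connected disc + isolated zeros). [folklore] -/
theorem exists_radius {H : ℂ → ℂ} {ρ' : ℝ} (hH : DifferentiableOn ℂ H (ball 0 ρ')) {z₀ z₁ : ℂ}
    (hz₀ : ‖z₀‖ < ρ') (hz₁ : ‖z₁‖ < ρ') (h1 : H z₁ ≠ 0) :
    ∃ ε : ℝ, 0 < ε ∧ ‖z₀‖ + ε < ρ' ∧ ∀ z : ℂ, 0 < ‖z - z₀‖ → ‖z - z₀‖ ≤ ε → H z ≠ 0 := by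
  have hA : AnalyticOnNhd ℂ H (ball 0 ρ') := hH.analyticOnNhd isOpen_ball
  have hev : ∀ᶠ z in 𝓝[≠] z₀, H z ≠ 0 := by
    rcases (hA z₀ (mem_ball_zero_iff.2 hz₀)).eventually_eq_zero_or_eventually_ne_zero with h | h
    · exact absurd (hA.eqOn_zero_of_preconnected_of_eventuallyEq_zero
        (convex_ball 0 ρ').isPreconnected (mem_ball_zero_iff.2 hz₀) h (mem_ball_zero_iff.2 hz₁)) h1
    · exact h
  obtain ⟨ε₁, hε₁, hε₁'⟩ := Metric.eventually_nhds_iff.1 (eventually_nhdsWithin_iff.1 hev)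
  refine ⟨min (ε₁ / 2) ((ρ' - ‖z₀‖) / 2), lt_min (by linarith) (by linarith), ?_, ?_⟩
  · have := min_le_right (ε₁ / 2) ((ρ' - ‖z₀‖) / 2)
    linarith
  · intro z hz hzε
    have hlt : dist z z₀ < ε₁ := by
      rw [dist_eq_norm]
      have := min_le_left (ε₁ / 2) ((ρ' - ‖z₀‖) / 2)
      linarith
    exact hε₁' hlt (mem_compl_singleton_iff.2 (sub_ne_zero.1 (norm_pos_iff.1 hz)))

/-! ### The regularised family `h_t = e^{-s_t} w` and its holomorphic approximations -/

/-- **The approximation package.** With a cut-off `χ` (`= 1` on `‖z‖ ≤ ρ''`, vanishing off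
`‖z‖ < ρ`, `‖χ‖ ≤ 1`), the localised coefficient `r̃ = χ r` satisfies `‖r̃‖ ≤ M ‖w‖` everywhere
and vanishes for `‖z‖ ≥ ρ`; for `t > 0` the regularised coefficient of `(w, r̃)` with `δ = t²`
has a smooth potential `s` with `‖s‖ ≤ 4ρM ≤ S` on `‖z‖ ≤ ρ`, and `h = e^{-s} w` has
`‖∂̄ h‖ ≤ e^S M t / 2` on `‖z‖ ≤ ρ''`, hence is `C e^S M t / 2`-close on `‖z‖ ≤ ρ'` to a function
`H` holomorphic on `‖z‖ < ρ'`. [folklore] -/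
theorem exists_approx {w r χ : ℂ → ℂ} {M ρ ρ' ρ'' C S : ℝ} (hM : 0 ≤ M) (hρ : 0 ≤ ρ)
    (hρ'' : ρ'' ≤ ρ) (hS : 2 * (ρ + ρ) * M ≤ S)
    (hw : ContDiff ℝ ∞ w) (hr : ContDiff ℝ ∞ r) (hdbar : ∀ η, dbarAlong 1 w η = r η)
    (hbound : ∀ η : ℂ, ‖η‖ ≤ ρ → ‖r η‖ ≤ M * ‖w η‖)
    (hχ : ContDiff ℝ ∞ χ) (hχ1 : ∀ z : ℂ, ‖z‖ ≤ ρ'' → χ z = 1)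
    (hχ0 : ∀ z : ℂ, χ z ≠ 0 → ‖z‖ < ρ) (hχle : ∀ z : ℂ, ‖χ z‖ ≤ 1)
    (hC : ∀ (k : ℂ → ℂ) (ε : ℝ), ContDiff ℝ ∞ k → 0 ≤ ε →
      (∀ η : ℂ, ‖η‖ ≤ ρ'' → ‖dbarAlong 1 k η‖ ≤ ε) →
      ∃ H : ℂ → ℂ, DifferentiableOn ℂ H (ball 0 ρ') ∧ ∀ η : ℂ, ‖η‖ ≤ ρ' → ‖k η - H η‖ ≤ C * ε)
    {t : ℝ} (ht : 0 < t) :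
    ∃ s H : ℂ → ℂ, ContDiff ℝ ∞ s ∧ (∀ z : ℂ, ‖z‖ ≤ ρ → ‖s z‖ ≤ S) ∧
      DifferentiableOn ℂ H (ball 0 ρ') ∧
      ∀ z : ℂ, ‖z‖ ≤ ρ' → ‖Complex.exp (-s z) * w z - H z‖ ≤ C * (Real.exp S * (M * t / 2)) := by
  -- the localised coefficient `r̃ = χ r`
  set r' : ℂ → ℂ := fun η => χ η * r η with hr'_def
  have hr' : ContDiff ℝ ∞ r' := hχ.mul hr
  have hsupp : ∀ η : ℂ, ρ ≤ ‖η‖ → r' η = 0 := fun η hη => by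
    have hχη : χ η = 0 := by
      by_contra h
      exact (not_lt.2 hη) (hχ0 η h)
    simp [hr'_def, hχη]
  have hbound' : ∀ η, ‖r' η‖ ≤ M * ‖w η‖ := fun η => by
    by_cases hη : ‖η‖ ≤ ρ
    · calc ‖r' η‖ = ‖χ η‖ * ‖r η‖ := norm_mul _ _
        _ ≤ 1 * (M * ‖w η‖) := mul_le_mul (hχle η) (hbound η hη) (norm_nonneg _) zero_le_one
        _ = M * ‖w η‖ := one_mul _
    · rw [hsupp η (not_le.1 hη).le, norm_zero]
      positivity
  -- the regularised coefficient with `δ = t²`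
  obtain ⟨ha, hac, haM, har⟩ :=
    regularisedCoefficient w r' M ρ (t ^ 2) hM (by positivity) hw hr' hbound' hsupp
  set a : ℂ → ℂ := fun η => r' η * conj (w η) / (((‖w η‖ ^ 2 + t ^ 2 : ℝ)) : ℂ)
    with ha_def
  have ha0 : ∀ η : ℂ, ρ ≤ ‖η‖ → a η = 0 := fun η hη => by simp [ha_def, hsupp η hη]
  have har' : ∀ η, ‖r' η - a η * w η‖ ≤ M * t / 2 := fun η => by
    have := har η
    rwa [Real.sqrt_sq ht.le] at this
  -- the potential
  obtain ⟨s, hs, hds, hsS⟩ := exists_potential (ρ := ρ) hρ hρ hM ha hac haM ha0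
  have hsS' : ∀ z : ℂ, ‖z‖ ≤ ρ → ‖s z‖ ≤ S := fun z hz => (hsS z hz).trans hS
  have hsd : Differentiable ℝ s := hs.differentiable (by simp)
  have hwd : Differentiable ℝ w := hw.differentiable (by simp)
  -- the modified function `h = e^{-s} w`
  set h : ℂ → ℂ := fun z => Complex.exp (-s z) * w z with hh_def
  have hh : ContDiff ℝ ∞ h := hs.neg.cexp.mul hw
  have hdh : ∀ z : ℂ, ‖z‖ ≤ ρ'' → ‖dbarAlong 1 h z‖ ≤ Real.exp S * (M * t / 2) := by
    intro z hz
    have hrz : r z = r' z := by simp [hr'_def, hχ1 z hz]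
    rw [hh_def, dbarAlong_one_exp_neg_mul (hsd z) (hwd z), hdbar z, hds z, norm_mul, hrz]
    exact mul_le_mul (norm_exp_neg_le (hsS' z (by linarith))) (har' z) (norm_nonneg _)
      (Real.exp_pos S).le
  obtain ⟨H, hH, hHh⟩ := hC h (Real.exp S * (M * t / 2)) hh (by positivity) hdh
  exact ⟨s, H, hs, hsS', hH, hHh⟩

/-! ### Rouché transfer along a small circle around `z₀` -/

/-- **Rouché transfer.** Let `γ` be the circle `‖z - z₀‖ = ε` inside the disc `‖z‖ < ρ'`, let
`H_k → H` locally uniformly on the disc with `‖e^{-s_k} w - H_k‖ ≤ e_k → 0` on `‖z‖ ≤ ρ'`, and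
suppose `w` and `H` have no zero on the circle. Then `wind (w ∘ γ) = wind (H ∘ γ)`: for `k`
large `e^{-s_k ∘ γ} (w ∘ γ)` is Rouché-close to `H ∘ γ`, and the exponential factor (the
exponential of a periodic function) does not wind. [folklore] -/
theorem wind_eq_of_approx {w Hlim : ℂ → ℂ} {Hk sk : ℕ → ℂ → ℂ} {e : ℕ → ℝ} {ρ' ε : ℝ} {z₀ : ℂ}
    (hε : 0 < ε) (hz₀ε : ‖z₀‖ + ε < ρ') (hw : Continuous w) (hs : ∀ k, Continuous (sk k))
    (hHlim : DifferentiableOn ℂ Hlim (ball 0 ρ'))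
    (hlim : TendstoLocallyUniformlyOn Hk Hlim atTop (ball 0 ρ'))
    (happ : ∀ k (z : ℂ), ‖z‖ ≤ ρ' → ‖Complex.exp (-sk k z) * w z - Hk k z‖ ≤ e k)
    (he : Tendsto e atTop (𝓝 0)) (hw0 : ∀ z : ℂ, ‖z - z₀‖ = ε → w z ≠ 0)
    (hH0 : ∀ z : ℂ, ‖z - z₀‖ = ε → Hlim z ≠ 0) :
    wind (fun t => w (circleLoop z₀ ε t)) = wind (fun t => Hlim (circleLoop z₀ ε t)) := by
  -- the closed disc `‖z - z₀‖ ≤ ε` lies in the open disc `‖z‖ < ρ'`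
  have hdisc : ∀ z : ℂ, ‖z - z₀‖ ≤ ε → ‖z‖ < ρ' := fun z hz => by
    have := norm_le_insert' z z₀
    linarith
  have hγ : ∀ t, ‖circleLoop z₀ ε t - z₀‖ = ε := fun t => by
    rw [norm_circleLoop_sub_center, abs_of_pos hε]
  have hγρ : ∀ t, ‖circleLoop z₀ ε t‖ < ρ' := fun t => hdisc _ (hγ t).le
  -- a positive lower bound `m` for `‖Hlim‖` on the circle
  obtain ⟨m, hm0, hm⟩ : ∃ m : ℝ, 0 < m ∧ ∀ z : ℂ, ‖z - z₀‖ = ε → m ≤ ‖Hlim z‖ := by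
    have hsub : sphere z₀ ε ⊆ ball 0 ρ' := fun z hz =>
      mem_ball_zero_iff.2 (hdisc z (mem_sphere_iff_norm.1 hz).le)
    obtain ⟨z₂, hz₂, hmin⟩ := (isCompact_sphere z₀ ε).exists_isMinOn
      ⟨z₀ + ε, by simp [mem_sphere_iff_norm, hε.le]⟩ (hHlim.continuousOn.mono hsub).norm
    exact ⟨‖Hlim z₂‖, norm_pos_iff.2 (hH0 z₂ (mem_sphere_iff_norm.1 hz₂)), fun z hz =>
      hmin (mem_sphere_iff_norm.2 hz)⟩
  -- uniform convergence on the closed disc, and smallness of the error, for `k` large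
  have hK : closedBall z₀ ε ⊆ ball 0 ρ' := fun z hz =>
    mem_ball_zero_iff.2 (hdisc z (mem_closedBall_iff_norm.1 hz))
  have hunif := (tendstoLocallyUniformlyOn_iff_forall_isCompact isOpen_ball).1 hlim
    (closedBall z₀ ε) hK (isCompact_closedBall z₀ ε)
  have hev1 : ∀ᶠ k in atTop, ∀ z ∈ closedBall z₀ ε, dist (Hlim z) (Hk k z) < m / 4 :=
    Metric.tendstoUniformlyOn_iff.1 hunif (m / 4) (by positivity)
  have hev2 : ∀ᶠ k in atTop, e k < m / 4 := he.eventually (gt_mem_nhds (by positivity))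
  obtain ⟨k, hk1, hk2⟩ := (hev1.and hev2).exists
  -- the loops along the circle
  have hHl : IsNonvanishingLoop (fun t => Hlim (circleLoop z₀ ε t)) :=
    ⟨hHlim.continuousOn.comp (continuous_circleLoop z₀ ε).continuousOn fun t _ =>
      mem_ball_zero_iff.2 (hγρ t), fun t _ => hH0 _ (hγ t), by rw [circleLoop_zero_eq]⟩
  have hwl : IsNonvanishingLoop (fun t => w (circleLoop z₀ ε t)) :=
    ⟨(hw.comp (continuous_circleLoop z₀ ε)).continuousOn, fun t _ => hw0 _ (hγ t),
      by rw [circleLoop_zero_eq]⟩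
  have hEl : IsNonvanishingLoop (fun t => Complex.exp (-sk k (circleLoop z₀ ε t))) :=
    ⟨(((hs k).comp (continuous_circleLoop z₀ ε)).neg.cexp).continuousOn,
      fun t _ => Complex.exp_ne_zero _, by rw [circleLoop_zero_eq]⟩
  have hEw : wind (fun t => Complex.exp (-sk k (circleLoop z₀ ε t))) = 0 :=
    wind_exp_eq_zero (l := fun t => -sk k (circleLoop z₀ ε t))
      (((hs k).comp (continuous_circleLoop z₀ ε)).neg).continuousOn (by rw [circleLoop_zero_eq])
  -- Rouché: `h_k ∘ γ` against `Hlim ∘ γ`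
  have hrouche : wind (fun t => Complex.exp (-sk k (circleLoop z₀ ε t)) * w (circleLoop z₀ ε t)) =
      wind (fun t => Hlim (circleLoop z₀ ε t)) := by
    refine wind_eq_of_norm_sub_lt (hEl.mul hwl).continuousOn (hEl.mul hwl).eq_endpoints hHl
      fun t _ => ?_
    have h1 := happ k (circleLoop z₀ ε t) (hγρ t).le
    have h2 := hk1 (circleLoop z₀ ε t) (mem_closedBall_iff_norm.2 (hγ t).le)
    rw [dist_eq_norm, norm_sub_rev] at h2
    have h3 := hm _ (hγ t)
    calc ‖Complex.exp (-sk k (circleLoop z₀ ε t)) * w (circleLoop z₀ ε t) -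
          Hlim (circleLoop z₀ ε t)‖
        ≤ ‖Complex.exp (-sk k (circleLoop z₀ ε t)) * w (circleLoop z₀ ε t) -
            Hk k (circleLoop z₀ ε t)‖ +
          ‖Hk k (circleLoop z₀ ε t) - Hlim (circleLoop z₀ ε t)‖ :=
          norm_sub_le_norm_sub_add_norm_sub _ _ _
      _ < m := by linarith
      _ ≤ ‖Hlim (circleLoop z₀ ε t)‖ := h3
  rw [← hrouche, wind_mul hEl hwl, hEw, zero_add]

/-- **The regularised family along `t = 1/(n+1)`, packaged.** Under `∂̄ w = r`, `‖r‖ ≤ M ‖w‖` on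
`‖z‖ ≤ ρ` (`0 ≤ M`) and `0 < ρ' < ρ`: smooth potentials `s n` bounded by `S` on the disc,
functions `Hn n` holomorphic on `‖z‖ < ρ'` and uniformly bounded there, with
`‖e^{-s n} w - Hn n‖ ≤ e n` on `‖z‖ ≤ ρ'` for an explicit null sequence `e n = A / (n + 1)`.
This is the input of the Montel step of the similarity principle. [folklore] -/
theorem exists_approx_seq {w r : ℂ → ℂ} {M ρ ρ' : ℝ} (hM : 0 ≤ M) (hρ' : 0 < ρ') (hρ : ρ' < ρ)
    (hw : ContDiff ℝ ∞ w) (hr : ContDiff ℝ ∞ r) (hdbar : ∀ η, dbarAlong 1 w η = r η)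
    (hbound : ∀ η : ℂ, ‖η‖ ≤ ρ → ‖r η‖ ≤ M * ‖w η‖) :
    ∃ (S A B : ℝ) (s Hn : ℕ → ℂ → ℂ), 0 ≤ A ∧ (∀ n, ContDiff ℝ ∞ (s n)) ∧
      (∀ n (z : ℂ), ‖z‖ ≤ ρ → ‖s n z‖ ≤ S) ∧ (∀ n, DifferentiableOn ℂ (Hn n) (ball 0 ρ')) ∧
      (∀ n (z : ℂ), ‖z‖ ≤ ρ' →
        ‖Complex.exp (-s n z) * w z - Hn n z‖ ≤ A * (1 / ((n : ℝ) + 1))) ∧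
      ∀ n, ∀ z ∈ ball (0 : ℂ) ρ', ‖Hn n z‖ ≤ B := by
  obtain ⟨C, hC0, hC⟩ := exists_holomorphic_approx_of_dbar_le ρ' ((ρ' + ρ) / 2) hρ' (by linarith)
  obtain ⟨χ, hχ, -, hχ1, hχ0, hχle⟩ :=
    Similarity.exists_cutoff (ρm := (ρ' + ρ) / 2) (ρ := ρ) (by linarith) (by linarith)
  set S : ℝ := 2 * (ρ + ρ) * M with hS_def
  have key : ∀ n : ℕ, ∃ s H : ℂ → ℂ, ContDiff ℝ ∞ s ∧ (∀ z : ℂ, ‖z‖ ≤ ρ → ‖s z‖ ≤ S) ∧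
      DifferentiableOn ℂ H (ball 0 ρ') ∧
      ∀ z : ℂ, ‖z‖ ≤ ρ' → ‖Complex.exp (-s z) * w z - H z‖ ≤
        C * (Real.exp S * (M * (1 / ((n : ℝ) + 1)) / 2)) := fun n =>
    exists_approx hM (by linarith) (by linarith) le_rfl hw hr hdbar hbound hχ hχ1 hχ0 hχle hC
      (by positivity)
  choose s Hn hs hsS hH happ using key
  obtain ⟨W, hW⟩ := (isCompact_closedBall (0 : ℂ) ρ').exists_bound_of_continuousOn
    hw.continuous.continuousOn
  refine ⟨S, C * Real.exp S * M / 2, Real.exp S * W + C * (Real.exp S * M), s, Hn,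
    by positivity, hs, hsS, hH, fun n z hz => ?_, fun n z hz => ?_⟩
  · have := happ n z hz
    calc ‖Complex.exp (-s n z) * w z - Hn n z‖
        ≤ C * (Real.exp S * (M * (1 / ((n : ℝ) + 1)) / 2)) := this
      _ = C * Real.exp S * M / 2 * (1 / ((n : ℝ) + 1)) := by ring
  · have hz' : ‖z‖ ≤ ρ' := (mem_ball_zero_iff.1 hz).le
    have h1 := happ n z hz'
    have h2 : ‖Complex.exp (-s n z) * w z‖ ≤ Real.exp S * W := by
      rw [norm_mul]
      exact mul_le_mul (norm_exp_neg_le (hsS n z (by linarith)))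
        (hW z (mem_closedBall_zero_iff.2 hz')) (norm_nonneg _) (Real.exp_pos S).le
    have h3 : C * (Real.exp S * (M * (1 / ((n : ℝ) + 1)) / 2)) ≤ C * (Real.exp S * M) := by
      refine mul_le_mul_of_nonneg_left (mul_le_mul_of_nonneg_left ?_ (Real.exp_pos S).le) hC0
      have : 1 / ((n : ℝ) + 1) ≤ 1 := by
        rw [div_le_one (by positivity)]
        linarith [n.cast_nonneg (α := ℝ)]
      nlinarith
    have h4 := norm_le_insert (Complex.exp (-s n z) * w z) (Hn n z)
    linarith

end Similarity

end Literature.Analysis.Complex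

end
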